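import Mathlib.Analysis.Calculus.MeanValue
import Literature.Analysis.FluidPDE.SverakLandauBernoulliK
import HarnessLib

/-!
# Šverák's classification of `(−1)`-homogeneous steady Navier–Stokes flows — back to `ℝ³ ∖ {0}`

Analysis/FluidPDE support file, sixth of the series `SverakLandau*` proving the named fact
`Literature.Analysis.FluidPDE.Sverak2011_landauClassification` (V. Šverák, J. Math. Sci. 179
(2011) = arXiv:math/0604550, Thm. 1).

The previous files work with globally smooth fields satisfying the equations on an open set; here
we return to the data of Šverák's theorem — `u`, `p` smooth on `Ω = {x | x ≠ 0}` only, solving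
`−Δu + (u·∇)u + ∇p = 0`, `div u = 0` there, with `t u(t x) = u(x)` — via the cut-off
regularisation of `SverakLandauRegularize` (`δ = |x₀|/2` around each `x₀ ≠ 0`).  With
`F = ⟪x, u⟫`, `P₂ = −½∑ⱼ xⱼ∂ⱼp` and the Bernoulli function `K = |x|²(½|u|² + P₂) − ½F² − F`
(all three passed as variables with defining equations) we prove, on `Ω`:

* `Sverak2011.transfer_equations` — the regularisations satisfy the equations, incompressibility
  and Euler's relation `DU(y) y = −U(y)` on `{y | δ < |y|}`;
* `Sverak2011.bernoulliK_identity` — **`∑ₗ ∂ₗ∂ₗK − ∑ₗ uₗ∂ₗK = ⟪x, curl u⟫²` at every `x ≠ 0`**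
  (the `ℝ³ ∖ {0}` form of `−Δ_{S²}c + v·∇c = −ω²` for Šverák's `c = ½|v|² + p − f`), together with
  the radial-profile identity `−∑ₗ ∂ₗ∂ₗF + ∑ₗ uₗ∂ₗF = |u|² + 2P₂` (`Sverak2011.radialF_identity`);
* `Sverak2011.contDiffOn_bernoulliK` — `K` is smooth on `Ω`;
* `Sverak2011.euler_P₂`, `Sverak2011.P₂_smul`, `Sverak2011.bernoulliK_smul` — `P₂` is homogeneous
  of degree `−2` along rays (Euler's relation integrated along `t ↦ t x`) and hence **`K` is
  `0`-homogeneous**, `K(t x) = K(x)`;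
* `Sverak2011.inner_curl_eq` — the right-hand side is `⟪x, curl u x⟫²` for the tree's `curl`.

The next file applies E. Hopf's strong maximum principle to `−K`.

## References

* V. Šverák, *On Landau's solutions of the Navier–Stokes equations*, J. Math. Sci. 179 (2011)
  208–228, arXiv:math/0604550, §4. [`Sverak2011`]
-/

noncomputable section

open Set Filter Metric
open scoped Topology BigOperators ContDiff Laplacian RealInnerProductSpace

namespace Literature.Analysis.FluidPDE

namespace Sverak2011

section Transfer

variable {u U : EuclideanSpace ℝ (Fin 3) → EuclideanSpace ℝ (Fin 3)}
  {p P : EuclideanSpace ℝ (Fin 3) → ℝ} {δ : ℝ}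

/-- Points of `{y | δ < |y|}` (`δ > 0`) are nonzero. [folklore] -/
theorem ne_zero_of_lt_norm (hδ : 0 < δ) {y : EuclideanSpace ℝ (Fin 3)} (hy : δ < ‖y‖) : y ≠ 0 := by
  rintro rfl; rw [norm_zero] at hy; exact lt_irrefl _ (hδ.trans hy)

/-- The set `{y | δ < |y|}` is open. [folklore] -/
theorem isOpen_lt_norm (δ : ℝ) : IsOpen {y : EuclideanSpace ℝ (Fin 3) | δ < ‖y‖} :=
  isOpen_lt continuous_const continuous_norm

/-- **Transfer of the equations to the regularisation.** If `U = u`, `P = p` on `{δ ≤ |x|}`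
(`δ > 0`) with `U`, `P` smooth, and `u`, `p` satisfy the steady Navier–Stokes equations,
incompressibility and the scaling `t u(tx) = u(x)` on `{x ≠ 0}` (`u` smooth there), then `U`, `P`
satisfy the equations, incompressibility and Euler's relation `DU(y) y = −U(y)` on the open set
`{δ < |y|}`. [folklore] -/
theorem transfer_equations (hδ : 0 < δ) (hu : ContDiffOn ℝ ∞ u {x | x ≠ 0})
    (hns : ∀ x, x ≠ 0 → -(Δ u) x + convect u u x + gradient p x = 0)
    (hdiv : ∀ x, x ≠ 0 → VectorCalculus.divergence u x = 0)
    (hhom : ∀ (t : ℝ) (x : EuclideanSpace ℝ (Fin 3)), 0 < t → x ≠ 0 → t • u (t • x) = u x)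
    (hUu : ∀ x, δ ≤ ‖x‖ → U x = u x) (hPp : ∀ x, δ ≤ ‖x‖ → P x = p x) :
    (∀ y ∈ {y : EuclideanSpace ℝ (Fin 3) | δ < ‖y‖}, -(Δ U) y + convect U U y + gradient P y = 0) ∧
    (∀ y ∈ {y : EuclideanSpace ℝ (Fin 3) | δ < ‖y‖}, VectorCalculus.divergence U y = 0) ∧
    (∀ y ∈ {y : EuclideanSpace ℝ (Fin 3) | δ < ‖y‖}, fderiv ℝ U y y = -U y) := by
  have hUev : ∀ y : EuclideanSpace ℝ (Fin 3), δ < ‖y‖ → U =ᶠ[𝓝 y] u := fun y hy =>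
    eventuallyEq_of_eq_of_le_norm hUu hy
  have hPev : ∀ y : EuclideanSpace ℝ (Fin 3), δ < ‖y‖ → P =ᶠ[𝓝 y] p := fun y hy =>
    eventuallyEq_of_eq_of_le_norm hPp hy
  refine ⟨fun y hy => ?_, fun y hy => ?_, fun y hy => ?_⟩
  · have hy0 := ne_zero_of_lt_norm hδ hy
    have h := hns y hy0
    have hL : (Δ U) y = (Δ u) y := (InnerProductSpace.laplacian_congr_nhds (hUev y hy)).self_of_nhds
    simp only [convect_apply] at h ⊢
    rw [hL, (hUev y hy).fderiv_eq, (hUev y hy).self_of_nhds, (hPev y hy).gradient_eq]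
    exact h
  · have hy0 := ne_zero_of_lt_norm hδ hy
    unfold VectorCalculus.divergence
    rw [(hUev y hy).fderiv_eq]
    exact hdiv y hy0
  · have hy0 := ne_zero_of_lt_norm hδ hy
    rw [(hUev y hy).fderiv_eq, (hUev y hy).self_of_nhds]
    exact fderiv_apply_self_of_neg_one_homogeneous (fun t ht => hhom t y ht hy0)
      ((hu.contDiffAt (isOpen_compl_singleton.mem_nhds hy0)).differentiableAt (by simp))

end Transfer

section Original

variable {u : EuclideanSpace ℝ (Fin 3) → EuclideanSpace ℝ (Fin 3)} {p : EuclideanSpace ℝ (Fin 3) → ℝ}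
  {F P₂ K : EuclideanSpace ℝ (Fin 3) → ℝ}

/-- **The Bernoulli-function identity on `ℝ³ ∖ {0}`** (Šverák 2011, §4: the quantity
`c = ½|v|² + p − f`; here `K = |x|²(½|u|² + P₂) − ½F² − F` with `F = ⟪x, u⟫`,
`P₂ = −½∑ⱼ xⱼ∂ⱼp`, for the data of Theorem 1).  At every `x ≠ 0`:
`∑ₗ ∂ₗ∂ₗK(x) − ∑ₗ uₗ(x)∂ₗK(x) = (x₀(∂₁u₂ − ∂₂u₁) + x₁(∂₂u₀ − ∂₀u₂) + x₂(∂₀u₁ − ∂₁u₀))² = ⟪x, curl u⟫²`,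
and the radial-profile identity `−∑ₗ ∂ₗ∂ₗF + ∑ₗ uₗ∂ₗF = |u|² + 2P₂` holds at `x`. [cite: Sverak2011, §4 Lemma 1] -/
theorem bernoulliK_identity (hu : ContDiffOn ℝ ∞ u {x | x ≠ 0}) (hp : ContDiffOn ℝ ∞ p {x | x ≠ 0})
    (hns : ∀ x, x ≠ 0 → -(Δ u) x + convect u u x + gradient p x = 0)
    (hdiv : ∀ x, x ≠ 0 → VectorCalculus.divergence u x = 0)
    (hhom : ∀ (t : ℝ) (x : EuclideanSpace ℝ (Fin 3)), 0 < t → x ≠ 0 → t • u (t • x) = u x)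
    (hF : F = fun x => ∑ i, x i * u x i) (hP₂ : P₂ = fun x => -(2⁻¹ * ∑ j, x j * pderiv j p x))
    (hK : K = fun x => (∑ i, x i ^ 2) * (2⁻¹ * ∑ i, u x i ^ 2 + P₂ x) - 2⁻¹ * F x ^ 2 - F x)
    {x : EuclideanSpace ℝ (Fin 3)} (hx : x ≠ 0) :
    (∑ l, pderiv l (pderiv l K) x - ∑ l, u x l * pderiv l K x =
      (x 0 * (pderiv 1 (fun z => u z 2) x - pderiv 2 (fun z => u z 1) x) +
        x 1 * (pderiv 2 (fun z => u z 0) x - pderiv 0 (fun z => u z 2) x) +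
        x 2 * (pderiv 0 (fun z => u z 1) x - pderiv 1 (fun z => u z 0) x)) ^ 2) ∧
    (-∑ l, pderiv l (pderiv l F) x + ∑ l, u x l * pderiv l F x = ∑ i, u x i ^ 2 + 2 * P₂ x) ∧
    (∑ j, x j * pderiv j P₂ x = -2 * P₂ x) ∧
    ContDiffAt ℝ ∞ K x ∧ ContDiffAt ℝ ∞ P₂ x ∧ ContDiffAt ℝ ∞ F x := by
  -- regularise around `x`
  set δ : ℝ := ‖x‖ / 2 with hδ_def
  have hδ : 0 < δ := by have := norm_pos_iff.mpr hx; positivity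
  have hxS : δ < ‖x‖ := by have := norm_pos_iff.mpr hx; rw [hδ_def]; linarith
  obtain ⟨U, hU, hUu⟩ := exists_contDiff_eq_of_contDiffOn hu hδ
  obtain ⟨P, hP, hPp⟩ := exists_contDiff_eq_of_contDiffOn hp hδ
  obtain ⟨hnsU, hdivU, hEuU⟩ := transfer_equations hδ hu hns hdiv hhom hUu hPp
  have hS := isOpen_lt_norm δ
  -- `u = U`, `p = P` and their partials agree on `S = {δ < |y|}`
  have huU : EqOn u U {y | δ < ‖y‖} := fun y hy => (hUu y (le_of_lt hy)).symm
  have hpP : EqOn p P {y | δ < ‖y‖} := fun y hy => (hPp y (le_of_lt hy)).symm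
  have huUi : ∀ i, EqOn (fun z => u z i) (fun z => U z i) {y | δ < ‖y‖} := fun i y hy => by
    simp only [huU hy]
  -- the auxiliary functions built from `U`, `P` agree with `F`, `P₂`, `K` on `S`
  have hFU : EqOn F (fun y => ∑ i, y i * U y i) {y | δ < ‖y‖} := fun y hy => by
    rw [hF]; simp only [huU hy]
  have hP₂U : EqOn P₂ (fun y => -(2⁻¹ * ∑ j, y j * pderiv j P y)) {y | δ < ‖y‖} := fun y hy => by
    rw [hP₂]; simp only [pderiv_eqOn hS hpP _ hy]
  have hKU : EqOn K (fun y => (∑ i, y i ^ 2) * (2⁻¹ * ∑ i, U y i ^ 2 +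
      (fun y => -(2⁻¹ * ∑ j, y j * pderiv j P y)) y) -
      2⁻¹ * (fun y => ∑ i, y i * U y i) y ^ 2 - (fun y => ∑ i, y i * U y i) y) {y | δ < ‖y‖} :=
    fun y hy => by
      rw [hK]; beta_reduce; rw [hFU hy, hP₂U hy]; simp only [huU hy]
  have hmain := bernoulliK_identity_on hU hP hS hnsU hdivU hEuU rfl rfl rfl rfl rfl hxS
  have hrad := radialF_identity_on (F := fun y => ∑ i, y i * U y i)
    (P₂ := fun y => -(2⁻¹ * ∑ j, y j * pderiv j P y)) hU hnsU hdivU rfl rfl hxS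
  refine ⟨?_, ?_, ?_, ?_, ?_, ?_⟩
  · simp only [pderiv_pderiv_eqOn hS hKU _ _ hxS, pderiv_eqOn hS hKU _ hxS,
      pderiv_eqOn hS (huUi _) _ hxS, huU hxS]
    exact hmain
  · simp only [pderiv_pderiv_eqOn hS hFU _ _ hxS, pderiv_eqOn hS hFU _ hxS, huU hxS, hP₂U hxS]
    exact hrad
  · simp only [pderiv_eqOn hS hP₂U _ hxS, hP₂U hxS]
    beta_reduce
    rw [Finset.sum_congr rfl fun j _ =>
      congrArg (fun r => x j * r) (pderiv_P₂_eq_on hU hP hS hnsU hEuU rfl j hxS)]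
    ring
  · have hKs : ContDiff ℝ ∞ (fun y => (∑ i, y i ^ 2) * (2⁻¹ * ∑ i, U y i ^ 2 +
        (fun y => -(2⁻¹ * ∑ j, y j * pderiv j P y)) y) -
        2⁻¹ * (fun y => ∑ i, y i * U y i) y ^ 2 - (fun y => ∑ i, y i * U y i) y) :=
      contDiff_bernoulliK (r2 := fun y => ∑ i, y i ^ 2) (U2 := fun y => ∑ i, U y i ^ 2) hU hP
        rfl rfl rfl rfl rfl
    exact hKs.contDiffAt.congr_of_eventuallyEq (hKU.eventuallyEq_of_mem (hS.mem_nhds hxS))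
  · exact (contDiff_P₂ hP rfl).contDiffAt.congr_of_eventuallyEq
      (hP₂U.eventuallyEq_of_mem (hS.mem_nhds hxS))
  · exact (contDiff_radial hU).contDiffAt.congr_of_eventuallyEq
      (hFU.eventuallyEq_of_mem (hS.mem_nhds hxS))

/-- `K`, `P₂`, `F` are smooth on `{x | x ≠ 0}`. [folklore] -/
theorem contDiffOn_bernoulliK (hu : ContDiffOn ℝ ∞ u {x | x ≠ 0}) (hp : ContDiffOn ℝ ∞ p {x | x ≠ 0})
    (hns : ∀ x, x ≠ 0 → -(Δ u) x + convect u u x + gradient p x = 0)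
    (hdiv : ∀ x, x ≠ 0 → VectorCalculus.divergence u x = 0)
    (hhom : ∀ (t : ℝ) (x : EuclideanSpace ℝ (Fin 3)), 0 < t → x ≠ 0 → t • u (t • x) = u x)
    (hF : F = fun x => ∑ i, x i * u x i) (hP₂ : P₂ = fun x => -(2⁻¹ * ∑ j, x j * pderiv j p x))
    (hK : K = fun x => (∑ i, x i ^ 2) * (2⁻¹ * ∑ i, u x i ^ 2 + P₂ x) - 2⁻¹ * F x ^ 2 - F x) :
    ContDiffOn ℝ ∞ K {x | x ≠ 0} ∧ ContDiffOn ℝ ∞ P₂ {x | x ≠ 0} ∧ ContDiffOn ℝ ∞ F {x | x ≠ 0} :=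
  ⟨fun _ hx => (bernoulliK_identity hu hp hns hdiv hhom hF hP₂ hK hx).2.2.2.1.contDiffWithinAt,
    fun _ hx => (bernoulliK_identity hu hp hns hdiv hhom hF hP₂ hK hx).2.2.2.2.1.contDiffWithinAt,
    fun _ hx => (bernoulliK_identity hu hp hns hdiv hhom hF hP₂ hK hx).2.2.2.2.2.contDiffWithinAt⟩

/-- **`P₂` is homogeneous of degree `−2` along rays**: `P₂(t x) = t⁻² P₂(x)` for `t > 0`, `x ≠ 0`
(Euler's relation `DP₂(y) y = −2P₂(y)` on `{y ≠ 0}` integrated along `t ↦ t x`; Šverák 2011,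
§4: "a suitable pressure … which is `(−2)`-homogeneous"). [cite: Sverak2011, §4] -/
theorem P₂_smul (hu : ContDiffOn ℝ ∞ u {x | x ≠ 0}) (hp : ContDiffOn ℝ ∞ p {x | x ≠ 0})
    (hns : ∀ x, x ≠ 0 → -(Δ u) x + convect u u x + gradient p x = 0)
    (hdiv : ∀ x, x ≠ 0 → VectorCalculus.divergence u x = 0)
    (hhom : ∀ (t : ℝ) (x : EuclideanSpace ℝ (Fin 3)), 0 < t → x ≠ 0 → t • u (t • x) = u x)
    (hF : F = fun x => ∑ i, x i * u x i) (hP₂ : P₂ = fun x => -(2⁻¹ * ∑ j, x j * pderiv j p x))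
    (hK : K = fun x => (∑ i, x i ^ 2) * (2⁻¹ * ∑ i, u x i ^ 2 + P₂ x) - 2⁻¹ * F x ^ 2 - F x)
    {t : ℝ} (ht : 0 < t) {x : EuclideanSpace ℝ (Fin 3)} (hx : x ≠ 0) :
    P₂ (t • x) = (t ^ 2)⁻¹ * P₂ x := by
  -- Euler's relation for `P₂` at every point of `{y ≠ 0}`, in Fréchet form
  have hE : ∀ y : EuclideanSpace ℝ (Fin 3), y ≠ 0 → fderiv ℝ P₂ y y = -2 * P₂ y := fun y hy => by
    rw [fderiv_apply_eq_sum_mul_pderiv]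
    exact (bernoulliK_identity hu hp hns hdiv hhom hF hP₂ hK hy).2.2.1
  have hd : ∀ y : EuclideanSpace ℝ (Fin 3), y ≠ 0 → DifferentiableAt ℝ P₂ y := fun y hy =>
    (bernoulliK_identity hu hp hns hdiv hhom hF hP₂ hK hy).2.2.2.2.1.differentiableAt (by simp)
  -- `g(s) = s² P₂(s x)` has zero derivative on `(0, ∞)`
  set g : ℝ → ℝ := fun s => s ^ 2 * P₂ (s • x) with hg
  have hsx : ∀ s : ℝ, 0 < s → s • x ≠ 0 := fun s hs => smul_ne_zero hs.ne' hx
  have hderiv : ∀ s : ℝ, 0 < s → HasDerivAt g 0 s := by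
    intro s hs
    have h1 : HasDerivAt (fun s : ℝ => s • x) x s := by
      simpa using (hasDerivAt_id s).smul_const x
    have h2 : HasDerivAt (fun s : ℝ => P₂ (s • x)) (fderiv ℝ P₂ (s • x) x) s :=
      (hd _ (hsx s hs)).hasFDerivAt.comp_hasDerivAt s h1
    have h3 : HasDerivAt g (↑2 * s ^ (2 - 1) * P₂ (s • x) + s ^ 2 * fderiv ℝ P₂ (s • x) x) s :=
      (hasDerivAt_pow 2 s).mul h2
    have h4 : fderiv ℝ P₂ (s • x) x = s⁻¹ * (-2 * P₂ (s • x)) := by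
      rw [← hE _ (hsx s hs), map_smul, smul_eq_mul, ← mul_assoc, inv_mul_cancel₀ hs.ne', one_mul]
    rw [h4] at h3
    convert h3 using 1
    field_simp
    ring
  have hconst := IsOpen.is_const_of_deriv_eq_zero (f := g) isOpen_Ioi isPreconnected_Ioi
    (fun s hs => (hderiv s hs).differentiableAt.differentiableWithinAt)
    (fun s hs => (hderiv s hs).deriv) ht (zero_lt_one' ℝ)
  simp only [hg, one_pow, one_smul, one_mul] at hconst
  rw [← hconst]
  field_simp

/-- **The Bernoulli function is `0`-homogeneous**: `K(t x) = K(x)` for `t > 0`, `x ≠ 0`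
(`|tx|² = t²|x|²`, `|u(tx)|² = t⁻²|u(x)|²`, `P₂(tx) = t⁻²P₂(x)`, `F(tx) = F(x)`). [folklore] -/
theorem bernoulliK_smul (hu : ContDiffOn ℝ ∞ u {x | x ≠ 0}) (hp : ContDiffOn ℝ ∞ p {x | x ≠ 0})
    (hns : ∀ x, x ≠ 0 → -(Δ u) x + convect u u x + gradient p x = 0)
    (hdiv : ∀ x, x ≠ 0 → VectorCalculus.divergence u x = 0)
    (hhom : ∀ (t : ℝ) (x : EuclideanSpace ℝ (Fin 3)), 0 < t → x ≠ 0 → t • u (t • x) = u x)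
    (hF : F = fun x => ∑ i, x i * u x i) (hP₂ : P₂ = fun x => -(2⁻¹ * ∑ j, x j * pderiv j p x))
    (hK : K = fun x => (∑ i, x i ^ 2) * (2⁻¹ * ∑ i, u x i ^ 2 + P₂ x) - 2⁻¹ * F x ^ 2 - F x)
    {t : ℝ} (ht : 0 < t) {x : EuclideanSpace ℝ (Fin 3)} (hx : x ≠ 0) :
    K (t • x) = K x := by
  have hut : u (t • x) = t⁻¹ • u x := by
    rw [← hhom t x ht hx, smul_smul, inv_mul_cancel₀ ht.ne', one_smul]
  have hFt : F (t • x) = F x := by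
    rw [hF]; beta_reduce
    simp only [hut, PiLp.smul_apply, smul_eq_mul]
    rw [Finset.sum_congr rfl fun i _ => show t * x i * (t⁻¹ * u x i) = x i * u x i by
      field_simp]
  rw [hK]; beta_reduce
  rw [hFt, P₂_smul hu hp hns hdiv hhom hF hP₂ hK ht hx]
  simp only [hut, PiLp.smul_apply, smul_eq_mul]
  have e1 : ∑ i, (t * x i) ^ 2 = t ^ 2 * ∑ i, x i ^ 2 := by
    rw [Finset.mul_sum]; exact Finset.sum_congr rfl fun i _ => by ring
  have e2 : ∑ i, (t⁻¹ * u x i) ^ 2 = (t ^ 2)⁻¹ * ∑ i, u x i ^ 2 := by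
    rw [Finset.mul_sum]; exact Finset.sum_congr rfl fun i _ => by ring
  rw [e1, e2]
  field_simp

/-- The coordinate expression of the series is the radial vorticity of the tree's `curl`:
`x₀(∂₁u₂ − ∂₂u₁) + x₁(∂₂u₀ − ∂₀u₂) + x₂(∂₀u₁ − ∂₁u₀) = ⟪x, curl u(x)⟫` (`u` differentiable at
`x`). [folklore] -/
theorem inner_curl_eq {x : EuclideanSpace ℝ (Fin 3)} (hd : DifferentiableAt ℝ u x) :
    ⟪x, curl u x⟫ = x 0 * (pderiv 1 (fun z => u z 2) x - pderiv 2 (fun z => u z 1) x) +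
      x 1 * (pderiv 2 (fun z => u z 0) x - pderiv 0 (fun z => u z 2) x) +
      x 2 * (pderiv 0 (fun z => u z 1) x - pderiv 1 (fun z => u z 0) x) := by
  have hD : ∀ j i, fderiv ℝ u x (EuclideanSpace.single j 1) i = pderiv j (fun z => u z i) x :=
    fun j i => by rw [euclidean_fderiv_apply_comp hd]; rfl
  simp only [curl, PiLp.inner_apply, RCLike.inner_apply, conj_trivial, Fin.sum_univ_three, hD]
  simp only [Fin.isValue, Matrix.cons_val_zero, Matrix.cons_val_one, Matrix.cons_val]
  ring

end Original

end Sverak2011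

end Literature.Analysis.FluidPDE
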